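import Literature.AnabelianGeometry.EtaleTheta.Discharge.Sec4GaloisActionToy
import Mathlib.CategoryTheory.InducedCategory
import HarnessLib

/-!
# [EtTh] §4: the Galois-SWAP toy (data) — a tempered-Frobenioid interface over a two-object groupoid base
# whose automorphism `ℤ/2` SWAPS the two primes of `Φ = (ℚ_{≥0})²`, with two NON-natural Galois
# representatives `Π^tp_X ↠ Aut_D(Y)`, `Π^tp_X ↠ Aut_D(Y′)`

S. Mochizuki, *The étale theta function and its Frobenioid-theoretic manifestations*, Publ. RIMS **45**
(2009) [MochizukiEtTh2009], §3 Def. 3.3 (iii) p.73, Def. 3.6 (i)–(ii) pp.76–77 (data of a tempered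
Frobenioid), §4 Def. 4.1 (ii) p.87 («the natural surjective outer homomorphism `Π^tp_X ↠ Aut_D(A^bs)`»),
Prop. 4.3 (i) p.90, proof p.91 («this follows from the fact that `H_⊙` acts trivially on `A_⊙^bs`»).

TOY DATA (abc-iut cell, block F, seat abc-iut-f-111, FACT-LIST row F-0492 `BiKummerSetting.Prop43_i`, the
¬∀ half; the positive half is abc-iut-f-109's `prop43_i_of_galoisSurjNatural'`, p438088: for EVERY setting,
`Prop43_i ⇐ GaloisSurjNatural`).  abc-iut-L2-t3's hypothesis structure `BiKummerSetting` carries the Galois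
surjections `galoisSurj A : Π^tp_X ↠ Aut_D(A)` of Def. 4.1 (ii) as ONE representative per Galois object, with
NO naturality between objects (the printed word «outer»; the owner-named law `GaloisSurjNatural`).  This file
builds the objects of a setting in which that law fails in the way the proof of Prop. 4.3 (i) uses it:
* the base `D = D₀ := ToySwap.Base`, the connected, totally epimorphic (NOT skeletal) groupoid with two
  isomorphic objects `Y`, `Y′` and every Hom-set `= ℤ/2` (`InducedCategory (SingleObj (ℤ/2)) (Bool → ∗)`);
* `Φ₀ = Φ^{ℝ-log} = Φ := (ℚ_{≥0})²` — two primes `𝔭₁`, `𝔭₂` — on which the generator `σ` of every Hom-set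
  acts by the SWAP (`ToySwap.act`), so that a base automorphism moves divisors; `B₀ = B₀^Λ := Φ₀^gp` (every
  divisor principal), `F₀ = F₀^Λ = ℝ·Φ₀^cnst := Ker(δ)`, `δ = 𝔭₁ − 𝔭₂`-coordinate difference (the swap-stable
  DIAGONAL, `≅ ℚ_{≥0}` — so Def. 3.6 (ii)(a) «`Φ^{bs-fld}` monoprime» and (b) stay REAL), monoid type `ℤ`;
  the tempered-Frobenioid interface `ToySwap.tf` over the trivial [FrdI] vocabularies;
The sequel `Sec4GaloisSwapToyProp43i.lean` supplies `Π^tp_X` (abc-iut-w5-d218's inhabitant of the [EtTh] §1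
interface over `K = ℚ̄`) with a surjection `Π^tp_X ↠ (ℤ/2)²` obtained from the interface's own fields
(`deltaHat_free`, `isProfiniteCompletion_toHat`), takes as the two Galois representatives its two coordinates
`galoisSurj Y := pr₁`, `galoisSurj Y′ := pr₂` (both onto `ℤ/2 = Aut_D(−)`, NOT related by an inner
automorphism), assembles the §4 setting (free trivial birational vocabulary, `A_⊙ := (Y, 0)`) and refutes the
universal closure of the typed `Prop43_i`: `H_⊙ = Ker(pr₁)` maps ONTO `Aut_D(Y′)` under `pr₂`, so
`H_A ∋ (1, σ, 0, 0)` for `A := (Y′, 0) ≅ A_⊙` although «`H_⊙` acts trivially on `A_⊙^bs`», and `σ` moves the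
zero divisor `𝔭₁` of a pre-step — exactly the input `GaloisSurjNatural` supplies.
This file holds DATA only (`def`s are toy objects; no `Prop`-valued definition, no named fact, no instance)
plus elementary lemmas about them.  HONEST LIMITS: a consistency/independence toy for the TYPED interfaces
(trivial [FrdI] vocabularies, `Π^tp` an abstract interface inhabitant, not a curve); consistency ≠
faithfulness; it says nothing about print's Prop. 4.3 (i), whose hypothesis IS the naturality; no side taken
on [IUTchIII] Cor. 3.12; typed ≠ proved.
-/

noncomputable section

namespace Literature.AnabelianGeometry.EtaleTheta

open CategoryTheory Opposite Literature.AlgebraicGeometry.Frobenioids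
open scoped NNRat

namespace ToySwap

/-! ## The base category: two isomorphic objects, every Hom-set `ℤ/2` -/

/-- The group `ℤ/2` (multiplicative notation). [cite: MochizukiEtTh2009, Def 4.1 p.87] -/
abbrev G : Type := Multiplicative (ZMod 2)

/-- The generator `σ` of `ℤ/2`. [cite: MochizukiEtTh2009, Def 4.1 p.87] -/
def σ : G := Multiplicative.ofAdd 1

/-- `σ ≠ 1` in `ℤ/2 = Aut_D(−)` of the toy base. [cite: MochizukiEtTh2009, Def 4.1 p.87] -/
theorem σ_ne_one : σ ≠ 1 := by decide

/-- `σ² = 1` in `ℤ/2 = Aut_D(−)` of the toy base. [cite: MochizukiEtTh2009, Def 4.1 p.87] -/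
theorem σ_mul_σ : σ * σ = 1 := by decide

/-- Every element of `ℤ/2 = Aut_D(−)` of the toy base is `1` or `σ`. [cite: MochizukiEtTh2009, Def 4.1 p.87] -/
theorem eq_one_or_eq_σ (g : G) : g = 1 ∨ g = σ := by
  revert g
  decide

/-- The base `D = D₀`: objects `Bool` (`Y := false`, `Y′ := true`), morphisms those of the one-object
groupoid `B(ℤ/2)` — a connected two-object groupoid. [cite: MochizukiEtTh2009, Def 3.3 p.73] -/
abbrev Base : Type := InducedCategory (SingleObj G) (fun _ : Bool => SingleObj.star G)

/-- The object `Y` (base of `A_⊙`). [cite: MochizukiEtTh2009, Def 4.1 p.86] -/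
abbrev Y : Base := false

/-- The object `Y′` (base of the domain `A ≅ A_⊙` of the fraction-pair). [cite: MochizukiEtTh2009, Def 4.1 p.86] -/
abbrev Y' : Base := true

/-- The morphism `A ⟶ B` of the base with underlying element `g ∈ ℤ/2`. [cite: MochizukiEtTh2009, Def 3.3 p.73] -/
abbrev homOf (A B : Base) (g : G) : A ⟶ B := InducedCategory.homMk (show SingleObj.star G ⟶ SingleObj.star G from g)

/-- The automorphism of a base object with underlying element `g`, as a group homomorphism
`ℤ/2 → Aut_D(A)`. [cite: MochizukiEtTh2009, Def 4.1 p.87] -/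
def autOf (A : Base) : G →* Aut A where
  toFun g :=
    { hom := homOf A A g
      inv := homOf A A (g⁻¹)
      hom_inv_id := InducedCategory.hom_ext (show (g⁻¹ * g : G) = 1 from inv_mul_cancel g)
      inv_hom_id := InducedCategory.hom_ext (show (g * g⁻¹ : G) = 1 from mul_inv_cancel g) }
  map_one' := Iso.ext (InducedCategory.hom_ext rfl)
  map_mul' g g' := Iso.ext (InducedCategory.hom_ext (show (g * g' : G) = g * g' from rfl))

/-- The underlying element of `autOf A g` is `g`. [cite: MochizukiEtTh2009, Def 4.1 p.87] -/
@[simp] theorem autOf_hom_hom (A : Base) (g : G) : (autOf A g).hom.hom = g := rfl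

/-- `autOf` is surjective: every automorphism of a base object is some `g ∈ ℤ/2`.
[cite: MochizukiEtTh2009, Def 4.1 p.87] -/
theorem autOf_surjective (A : Base) : Function.Surjective (autOf A) := fun α =>
  ⟨α.hom.hom, Iso.ext (InducedCategory.hom_ext rfl)⟩

/-- `autOf` is injective. [cite: MochizukiEtTh2009, Def 4.1 p.87] -/
theorem autOf_injective (A : Base) : Function.Injective (autOf A) := fun g g' h =>
  (autOf_hom_hom A g).symm.trans ((congrArg (fun e : Aut A => e.hom.hom) h).trans (autOf_hom_hom A g'))

/-- Every morphism of the base is an epimorphism (a groupoid). [cite: MochizukiEtTh2009, Def 3.6 p.77] -/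
theorem epi_base {A B : Base} (f : A ⟶ B) : Epi f :=
  ⟨fun g h e => by
    apply InducedCategory.hom_ext
    have e' := congrArg InducedCategory.Hom.hom e
    simp only [InducedCategory.comp_hom] at e'
    exact (cancel_epi f.hom).1 e'⟩

/-- Any two objects of the base are connected by a morphism. [cite: MochizukiEtTh2009, Def 3.6 p.77] -/
theorem isConnected_base : IsConnected Base := by
  haveI : Nonempty Base := ⟨Y⟩
  exact zigzag_isConnected fun j₁ j₂ => Zigzag.of_hom (homOf j₁ j₂ 1)

/-! ## The divisor monoid `(ℚ_{≥0})²` with the swap action, and the diagonal -/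

/-- `Φ₀(Y) := (ℚ_{≥0})²`: two primes `𝔭₁`, `𝔭₂` with rational multiplicities. [cite: MochizukiEtTh2009, Def 3.3 p.73] -/
abbrev M : Type := Multiplicative ℚ≥0 × Multiplicative ℚ≥0

/-- The swap of the two primes. [cite: MochizukiEtTh2009, Def 3.3 p.73] -/
def swapHom : M →* M := (MulEquiv.prodComm : M ≃* M).toMonoidHom

/-- Values of the swap. [cite: MochizukiEtTh2009, Def 3.3 p.73] -/
@[simp] theorem swapHom_apply (p : M) : swapHom p = (p.2, p.1) := rfl

/-- The action of `g ∈ ℤ/2 = Hom_D(A, B)` on `Φ₀` by pull-back: `1` acts trivially, `σ` swaps.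
[cite: MochizukiEtTh2009, Def 3.3 p.73] -/
def act (g : G) : M →* M := if g = 1 then MonoidHom.id M else swapHom

/-- `act 1 = id`. [cite: MochizukiEtTh2009, Def 3.3 p.73] -/
theorem act_one : act 1 = MonoidHom.id M := if_pos rfl

/-- `act σ = swap`. [cite: MochizukiEtTh2009, Def 3.3 p.73] -/
theorem act_σ : act σ = swapHom := if_neg σ_ne_one

/-- The action is multiplicative (`ℤ/2` is commutative and `swap ∘ swap = id`). [cite: MochizukiEtTh2009, Def 3.3 p.73] -/
theorem act_mul (g h : G) : act (g * h) = (act g).comp (act h) := by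
  rcases eq_one_or_eq_σ g with rfl | rfl <;> rcases eq_one_or_eq_σ h with rfl | rfl
  · rw [one_mul, act_one]; rfl
  · rw [one_mul, act_one, act_σ]; rfl
  · rw [mul_one, act_one, act_σ]; rfl
  · rw [σ_mul_σ, act_one, act_σ]; exact MonoidHom.ext fun p => rfl

/-- `Φ₀ = Φ₀^ℝ` as a monoid on the base: `(ℚ_{≥0})²` with the swap action. [cite: MochizukiEtTh2009, Def 3.3 p.73] -/
def Φfun : Baseᵒᵖ ⥤ CommMonCat.{0} where
  obj _ := CommMonCat.of M
  map f := CommMonCat.ofHom (act f.unop.hom)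
  map_id X := by
    apply CommMonCat.hom_ext
    rw [CommMonCat.hom_ofHom, CommMonCat.hom_id]
    change act (𝟙 (SingleObj.star G)) = _
    rw [SingleObj.id_as_one, act_one]
  map_comp f g := by
    apply CommMonCat.hom_ext
    rw [CommMonCat.hom_ofHom, CommMonCat.hom_comp, CommMonCat.hom_ofHom, CommMonCat.hom_ofHom, ← act_mul,
      mul_comm]
    rfl

/-- Pull-back in `Φ₀` along the morphism with underlying element `g` is `act g`.
[cite: MochizukiEtTh2009, Def 3.3 p.73] -/
theorem Φfun_map_apply {A B : Baseᵒᵖ} (f : A ⟶ B) (p : M) : (Φfun.map f).hom p = act f.unop.hom p := rfl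

/-- The coordinate difference `δ(𝔭₁^a 𝔭₂^b) := a − b ∈ ℚ` on `Φ₀`. [cite: MochizukiEtTh2009, Def 3.6 p.76] -/
def δ₀ : M →* Multiplicative ℚ where
  toFun p := Multiplicative.ofAdd (((Multiplicative.toAdd p.1 : ℚ≥0) : ℚ) - ((Multiplicative.toAdd p.2 : ℚ≥0) : ℚ))
  map_one' := by simp
  map_mul' p q := by
    rw [← ofAdd_add]
    congr 1
    simp only [Prod.fst_mul, Prod.snd_mul, toAdd_mul, NNRat.coe_add]
    ring

/-- `δ₀ p = 1 ↔` the two coordinates of `p` agree (the diagonal). [cite: MochizukiEtTh2009, Def 3.6 p.76] -/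
theorem δ₀_eq_one_iff (p : M) : δ₀ p = 1 ↔ p.1 = p.2 := by
  change Multiplicative.ofAdd _ = 1 ↔ _
  rw [ofAdd_eq_one, sub_eq_zero, NNRat.coe_inj]
  exact Multiplicative.toAdd.injective.eq_iff

/-- `δ₀ ∘ swap = δ₀⁻¹`. [cite: MochizukiEtTh2009, Def 3.6 p.76] -/
theorem δ₀_swapHom (p : M) : δ₀ (swapHom p) = (δ₀ p)⁻¹ := by
  change Multiplicative.ofAdd _ = (Multiplicative.ofAdd _)⁻¹
  rw [← ofAdd_neg, neg_sub]
  rfl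

/-- `δ : Φ₀^gp → ℚ`, the extension of `δ₀` to the groupification. [cite: MochizukiEtTh2009, Def 3.6 p.76] -/
def δ : Algebra.GrothendieckGroup M →* Multiplicative ℚ := Algebra.GrothendieckGroup.lift δ₀

/-- `δ` extends `δ₀`. [cite: MochizukiEtTh2009, Def 3.6 p.76] -/
@[simp] theorem δ_of (p : M) : δ (Algebra.GrothendieckGroup.of p) = δ₀ p := by
  have h := Algebra.GrothendieckGroup.lift.symm_apply_apply δ₀
  rw [Algebra.GrothendieckGroup.lift_symm_apply] at h
  exact DFunLike.congr_fun h p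

/-- `δ` changes at most by a sign under the action of `ℤ/2` on `Φ₀^gp`. [cite: MochizukiEtTh2009, Def 3.6 p.76] -/
theorem δ_gpMap_act (g : G) (x : Algebra.GrothendieckGroup M) :
    δ (gpMap (act g) x) = δ x ∨ δ (gpMap (act g) x) = (δ x)⁻¹ := by
  rcases eq_one_or_eq_σ g with rfl | rfl
  · left
    rw [act_one]
    exact congrArg δ (DFunLike.congr_fun (Literature.AlgebraicGeometry.Frobenioids.gpMap_id (M := M)) x)
  · right
    rw [act_σ]
    have key : δ.comp (gpMap swapHom) = δ⁻¹ :=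
      MonGp.hom_ext fun p => by rw [MonoidHom.comp_apply, gpMap_of, δ_of, δ₀_swapHom, MonoidHom.inv_apply, δ_of]
    exact DFunLike.congr_fun key x

/-- `Ker(δ)` is stable under the action of `ℤ/2` on `Φ₀^gp`. [cite: MochizukiEtTh2009, Def 3.6 p.76] -/
theorem δ_gpMap_act_eq_one {g : G} {x : Algebra.GrothendieckGroup M} (hx : δ x = 1) : δ (gpMap (act g) x) = 1 := by
  rcases δ_gpMap_act g x with h | h
  · rw [h, hx]
  · rw [h, hx, inv_one]

/-- `Ker(δ)` is root-closed: `δ(xⁿ) = 1`, `n ≥ 1` `⇒ δ(x) = 1` (`ℚ` is torsion-free). [cite: MochizukiEtTh2009, Def 3.6 p.76] -/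
theorem δ_eq_one_of_pow {x : Algebra.GrothendieckGroup M} {n : ℕ} (hn : n ≠ 0) (h : δ (x ^ n) = 1) : δ x = 1 := by
  rw [map_pow] at h
  have h' : n • Multiplicative.toAdd (δ x) = 0 := by
    rw [← toAdd_pow, h, toAdd_one]
  rcases smul_eq_zero.1 h' with h0 | h0
  · exact (hn h0).elim
  · exact Multiplicative.toAdd.injective (by rw [h0, toAdd_one])

/-- `(ℚ_{≥0})²` is a perfect monoid (every `n`-th power map, `n ≥ 1`, is bijective). [cite: MochizukiFrdI2008, §0 p.11] -/
theorem isPerfect_M : IsPerfect M := by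
  have hQ : IsPerfect (Multiplicative ℚ≥0) := isPerfect_of_mulEquiv_nnrat (MulEquiv.refl _)
  refine ⟨fun n hn => ⟨fun p q h => ?_, fun p => ?_⟩⟩
  · have h1 := congrArg Prod.fst h
    have h2 := congrArg Prod.snd h
    simp only [Prod.pow_fst, Prod.pow_snd] at h1 h2
    exact Prod.ext ((hQ.bijective_pow n hn).1 h1) ((hQ.bijective_pow n hn).1 h2)
  · obtain ⟨a, ha⟩ := (hQ.bijective_pow n hn).2 p.1
    obtain ⟨b, hb⟩ := (hQ.bijective_pow n hn).2 p.2
    exact ⟨(a, b), Prod.ext ha hb⟩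

/-- Perfectness transfers along multiplicative equivalences. [folklore] -/
private theorem isPerfect_of_mulEquiv' {N P : Type} [CommMonoid N] [CommMonoid P] (e : N ≃* P) (h : IsPerfect P) :
    IsPerfect N := by
  refine ⟨fun n hn => ?_⟩
  have hcomp : (fun a : N => a ^ n) = e.symm ∘ (fun b : P => b ^ n) ∘ e := by
    funext a
    change a ^ n = e.symm (e a ^ n)
    rw [← map_pow, e.symm_apply_apply]
  rw [hcomp]
  exact e.symm.bijective.comp ((h.bijective_pow n hn).comp e.bijective)

/-- `gpMap id = id`, pointwise. [folklore] -/
private theorem gpMap_id_apply' (x : Algebra.GrothendieckGroup M) : gpMap (MonoidHom.id M) x = x :=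
  DFunLike.congr_fun (Literature.AlgebraicGeometry.Frobenioids.gpMap_id (M := M)) x

/-! ## Def 3.3 (iii) / 3.6 (i) / 3.6 (ii) data -/

/-- **Def 3.3 (iii) data of the toy**: `Φ₀ = (ℚ_{≥0})²` with the swap action, `B₀ := Φ₀^gp` (all divisors
principal, `div₀ = id`), `F₀ := Ker(δ)` (the diagonal), everything non-cuspidal. [cite: MochizukiEtTh2009, Def 3.3 p.73] -/
def divisorMonoids : DivisorMonoids.{0, 0, 0} Base where
  Φ₀ := Φfun
  B₀ := monoidGp Φfun
  isUnit_B₀ _ b := by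
    change IsUnit (M := Algebra.GrothendieckGroup M) b
    exact Group.isUnit _
  div₀ _ := MonoidHom.id _
  div₀_natural _ _ := rfl
  F₀ _ := δ.ker.toSubmonoid
  F₀_map f b hb := by
    change δ (gpMap (act f.unop.hom) b) = 1
    exact δ_gpMap_act_eq_one hb
  ncsp₀ _ := ⊤
  csp₀ _ := ⊥
  ncsp₀_map _ _ _ := trivial
  csp₀_map _ x hx := by
    rw [Submonoid.mem_bot] at hx ⊢
    rw [hx, map_one]
  existsUnique_ncsp_csp _ x := by
    refine ⟨(⟨x, trivial⟩, ⟨1, Submonoid.mem_bot.mpr rfl⟩), mul_one x, ?_⟩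
    rintro ⟨a, c⟩ h
    have hc : c.1 = 1 := Submonoid.mem_bot.mp c.2
    have ha : a.1 = x := by
      have h' : a.1 * c.1 = x := h
      rwa [hc, mul_one] at h'
    exact Prod.ext (Subtype.ext ha) (Subtype.ext hc)

/-- **Def 3.6 (i) data of the toy** (`Λ = ℤ`, `Φ₀^ℝ = Φ₀`, `B₀^Λ = B₀ = Φ₀^gp`, `F₀^Λ = ℝ·Φ₀^cnst = Ker(δ)` — the
swap-stable, root-closed diagonal), over the trivial monoid vocabulary. [cite: MochizukiEtTh2009, Def 3.6 p.76] -/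
def realified : RealifiedDivisorMonoids (D₀ := Base) Toy.monoidVocab where
  toDivisorMonoids := divisorMonoids
  Λ := MonoidType.Z
  ΦR := Φfun
  toR _ := MonoidHom.id _
  toR_natural _ _ := rfl
  isRealification _ := trivial
  BΛ := monoidGp Φfun
  isUnit_BΛ _ b := by
    change IsUnit (M := Algebra.GrothendieckGroup M) b
    exact Group.isUnit _
  divΛ _ := MonoidHom.id _
  divΛ_natural _ _ := rfl
  FΛ _ := δ.ker.toSubmonoid
  FΛ_map f b hb := by
    change δ (gpMap (act f.unop.hom) b) = 1
    exact δ_gpMap_act_eq_one hb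
  cnstR _ := δ.ker
  cnstR_map f x hx := by
    change δ (gpMap (act f.unop.hom) x) = 1
    exact δ_gpMap_act_eq_one hx
  divΛ_mem_cnstR _ _ hb := hb
  cnstR_root _ g n hg := δ_eq_one_of_pow n.ne_zero hg
  cnst_le_cnstR _ b hb := by
    change δ (gpMap (MonoidHom.id M) b) = 1
    rw [gpMap_id_apply']
    exact hb
  ncspR _ := ⊤
  cspR _ := ⊥
  toR_ncsp _ _ _ := trivial
  toR_csp _ _ hx := hx

/-- The trivial [FrdI] category vocabulary on the base (every predicate `True`). [cite: MochizukiEtTh2009, Def 3.6 p.77] -/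
def catVocab : FrdICatStub.{0, 0, 0} Base where
  IsDivisorialOn _ := True
  IsRational _ := True
  IsStrictlyRational _ := True

/-- Membership in `Φ^{bs-fld}(A) = Φ(A) ∩ (ℝ·Φ₀^cnst)` of the toy: the diagonal of `(ℚ_{≥0})²`.
[cite: MochizukiEtTh2009, Def 3.6 p.77] -/
theorem mem_bsFld_iff (p : M) :
    p ∈ (⊤ : Submonoid M) ⊓ δ.ker.toSubmonoid.comap (Algebra.GrothendieckGroup.of (M := M)) ↔ p.1 = p.2 := by
  rw [Submonoid.mem_inf, Submonoid.mem_comap, Subgroup.mem_toSubmonoid, MonoidHom.mem_ker, δ_of, δ₀_eq_one_iff]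
  exact ⟨fun h => h.2, fun h => ⟨Submonoid.mem_top p, h⟩⟩

/-- `Φ^{bs-fld}(A) ≅ ℚ_{≥0}` (first coordinate): the diagonal of `(ℚ_{≥0})²` is `ℚ`-monoprime.
[cite: MochizukiEtTh2009, Def 3.6 p.77] -/
def bsFldEquiv :
    ↥((⊤ : Submonoid M) ⊓ δ.ker.toSubmonoid.comap (Algebra.GrothendieckGroup.of (M := M))) ≃* Multiplicative ℚ≥0 where
  toFun p := p.1.1
  invFun q := ⟨(q, q), (mem_bsFld_iff _).2 rfl⟩
  left_inv p := Subtype.ext (Prod.ext rfl ((mem_bsFld_iff p.1).1 p.2))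
  right_inv _ := rfl
  map_mul' _ _ := rfl

/-- **Def 3.6 (ii), the toy tempered-Frobenioid interface**: `D = D₀ = Base` (connected, totally epimorphic),
`Φ = Φ^{ℝ-log} = (ℚ_{≥0})²` (group-saturated), (a) `Φ^{bs-fld} =` the diagonal `≅ ℚ_{≥0}` monoprime (REAL),
(b) the constant `𝔭₁𝔭₂ ∈ F` has divisor `𝔭₁ + 𝔭₂ ≠ 0` (REAL). [cite: MochizukiEtTh2009, Def 3.6 p.77] -/
def tf : TemperedFrobenioid realified Base catVocab where
  isConnected := isConnected_base
  isTotallyEpimorphic := ⟨fun f => epi_base f⟩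
  base := 𝟭 _
  Φ := ⟨fun _ => ⊤, fun _ _ _ => trivial⟩
  isGroupSaturated A := (isGroupSaturated_iff' _).2 fun _ _ _ _ _ _ => trivial
  isPerfFactorial _ := trivial
  isDivisorialOn := trivial
  isMonoprime_bsFld _ := IsMonoprime.ofQ ⟨⟨bsFldEquiv⟩⟩
  exists_FΛ_div_ne A := by
    refine ⟨Algebra.GrothendieckGroup.of ((Multiplicative.ofAdd (1 : ℚ≥0), Multiplicative.ofAdd (1 : ℚ≥0)) : M),
      ?_, ((Multiplicative.ofAdd (1 : ℚ≥0), Multiplicative.ofAdd (1 : ℚ≥0)) : M), trivial, (1 : M), trivial,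
      fun h => one_ne_zero (Multiplicative.ofAdd.injective (congrArg Prod.fst h)), ?_⟩
    · show δ (Algebra.GrothendieckGroup.of (M := M) (Multiplicative.ofAdd (1 : ℚ≥0), Multiplicative.ofAdd (1 : ℚ≥0))) = 1
      rw [δ_of, δ₀_eq_one_iff]
    · show Algebra.GrothendieckGroup.of (M := M) (Multiplicative.ofAdd (1 : ℚ≥0), Multiplicative.ofAdd (1 : ℚ≥0)) =
        Algebra.GrothendieckGroup.of (M := M) (Multiplicative.ofAdd (1 : ℚ≥0), Multiplicative.ofAdd (1 : ℚ≥0)) /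
          Algebra.GrothendieckGroup.of (M := M) 1
      rw [(Algebra.GrothendieckGroup.of (M := M)).map_one, div_one]

/-- "monoid type `ℤ`". [cite: MochizukiEtTh2009, Def 4.1 p.86] -/
theorem tf_monoidType : tf.monoidType = MonoidType.Z := rfl

/-- "`Φ` is perfect": `Φ(A) = (ℚ_{≥0})²`. [cite: MochizukiEtTh2009, Def 4.1 p.86] -/
theorem tf_isPerfect (A : Baseᵒᵖ) : IsPerfect (tf.Φ.carrier A) :=
  isPerfect_of_mulEquiv' (N := ↥(⊤ : Submonoid M)) Submonoid.topEquiv isPerfect_M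

/-- `B` of the toy is objectwise group-like. [cite: MochizukiEtTh2009, Def 3.6 p.77] -/
theorem ratFnFunctor_isGroupLike : Objectwise (fun N _ => IsGroupLike N) tf.ratFnFunctor :=
  tf.ratFnFunctor_isGroupLike realified.isUnit_BΛ

/-- Pull-back in `Φ` along a base morphism is `act` of its underlying element (on values).
[cite: MochizukiEtTh2009, Def 3.6 p.76] -/
theorem coe_pull_Φ {A B : Base} (f : A ⟶ B) (x : tf.divisorMonoid.obj (op B)) :
    ((pull tf.divisorMonoid f x).1 : M) = act f.hom (x.1 : M) := rfl

end ToySwap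

end Literature.AnabelianGeometry.EtaleTheta

end
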